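import Mathlib.Analysis.InnerProductSpace.Laplacian
import Mathlib.Analysis.InnerProductSpace.PiL2
import Mathlib.Analysis.Calculus.FDeriv.Symmetric
import Mathlib.Analysis.SpecialFunctions.Pow.Real
import HarnessLib

/-!
# The Laplacian inequality for a classical solution of a second-order equation and for its
# first and second derivatives

Analysis/PDE support file, companion of `InteriorL2Estimates.lean` and `InteriorSupBound.lean`
on the discharge path of `Literature.Geometry.Lorentzian.exists_conformal_negativeMass_of_massZero`
(Schoen–Yau, Comm. Math. Phys. 65 (1979), proof of Lemma 3.2: the decay of the solution `v` of
`Δv - fv = h` *and of its first two derivatives*, (3.17)–(3.20), from *"standard linear elliptic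
estimates [17, p. 161]"*). The interior estimates of those files take as input a pointwise
inequality `|ΔU| ≤ ε √(Σ(∂²U)²) + L √(Σ(∂U)²) + L² |U| + G`; this file derives it, in a
finite-dimensional real inner product space with orthonormal basis `b` (`∂ₖ = D(·)(bₖ)`), for

* `U = u` (`abs_laplacian_le_of_eq`) — from an equation
  `Σₖₗ aₖₗ ∂ₗ∂ₖu + Σₖ βₖ ∂ₖu + c u = g` with `Σ|aₖₗ - δₖₗ| ≤ ε`, `Σ|βₖ| ≤ L₁`: `G = |g|`;
* `U = ∂ₘu` (`abs_laplacian_fderiv_le`) — for `u ∈ C³`, differentiable coefficients with first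
  derivatives `≤ Λ₁`: `G = |∂ₘg| + Λ₁ (Σ|∂²u| + Σ|∂u| + |u|)`, through the commutator identity
  `∂ₘ(Pu) = P(∂ₘu) + Σ ∂ₘaₖₗ ∂ₗ∂ₖu + Σ ∂ₘβₖ ∂ₖu + ∂ₘc u` (`fderiv_secondOrderOp_apply`);
* `U = ∂ₙ∂ₘu` (`abs_laplacian_fderiv_fderiv_le`) — for `u ∈ C⁴`, `C²` coefficients with second
  derivatives `≤ Λ₂`: `G = |∂ₙ∂ₘg| + Λ₁(Tₘ + Tₙ) + Λ₂ (Σ|∂²u| + Σ|∂u| + |u|)`,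
  `Tᵢ = Σ|∂²∂ᵢu| + Σ|∂∂ᵢu| + |∂ᵢu|` (`fderiv_commutator_apply`),

with the symmetry of mixed partial derivatives of `C²`/`C³` functions in the required pointwise
forms (`fderiv_fderiv_apply_comm`, `fderiv_fderiv_fderiv_comm`). Everything is proved; no
definitions and no named facts are introduced.

## References

* D. Gilbarg, N. S. Trudinger, *Elliptic partial differential equations of second order* (2001),
  §6.4 and proof of Thm. 8.10 (differentiating the equation for higher interior regularity).
  [GilbargTrudinger2001]
* R. Schoen, S.-T. Yau, Comm. Math. Phys. 65 (1979) 45–76, proof of Lemma 3.2, (3.17)–(3.20).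
  [SchoenYauPMT1979]
-/

noncomputable section

-- nested operator types `E →L[ℝ] E →L[ℝ] ℝ`
set_option maxSynthPendingDepth 3

open Set Function Filter InnerProductSpace
open scoped Laplacian ContDiff Topology

namespace Literature.Analysis.PDE

variable {E : Type*} [NormedAddCommGroup E] [InnerProductSpace ℝ E]

/-! ### Symmetry of mixed partial derivatives -/

section Symmetry

variable {f : E → ℝ} {y : E}

/-- Partial derivatives of a function `C²` at a point, through the second Fréchet derivative:
`∂_w(∂ᵥ f)(y) = D²f(y)(w)(v)`. [folklore] -/
theorem fderiv_fderiv_apply_eq_fderiv_fderiv (hf : ContDiffAt ℝ 2 f y) (v w : E) :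
    fderiv ℝ (fun z => fderiv ℝ f z v) y w = fderiv ℝ (fderiv ℝ f) y w v := by
  have hd : DifferentiableAt ℝ (fderiv ℝ f) y :=
    (hf.fderiv_right (m := 1) le_rfl).differentiableAt one_ne_zero
  rw [fderiv_clm_apply hd (differentiableAt_const v)]
  simp

/-- **Symmetry of second partial derivatives** for a function `C²` at a point:
`∂_w ∂ᵥ f = ∂ᵥ ∂_w f`. [folklore] -/
theorem fderiv_fderiv_apply_comm (hf : ContDiffAt ℝ 2 f y) (v w : E) :
    fderiv ℝ (fun z => fderiv ℝ f z v) y w = fderiv ℝ (fun z => fderiv ℝ f z w) y v := by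
  rw [fderiv_fderiv_apply_eq_fderiv_fderiv hf, fderiv_fderiv_apply_eq_fderiv_fderiv hf]
  exact hf.isSymmSndFDerivAt (by simp) w v

/-- The partial derivative `z ↦ ∂ᵥ f(z)` of a function `Cⁿ⁺¹` on an open set is `Cⁿ` there.
[folklore] -/
theorem contDiffOn_fderiv_apply_const {V : Set E} (hV : IsOpen V) {n : ℕ∞} 
    (hf : ContDiffOn ℝ (n + 1) f V) (v : E) : ContDiffOn ℝ n (fun z => fderiv ℝ f z v) V :=
  ((hf.fderiv_of_isOpen hV le_rfl).clm_apply contDiffOn_const)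

/-- **Commuting a partial derivative past two others** for a function `C³` on an open set:
`∂ₘ(∂ₗ ∂ₖ u) = ∂ₗ ∂ₖ (∂ₘ u)`. [folklore] -/
theorem fderiv_fderiv_fderiv_comm {u : E → ℝ} {V : Set E} (hV : IsOpen V) (hy : y ∈ V)
    (hu : ContDiffOn ℝ 3 u V) (k l m : E) :
    fderiv ℝ (fun z => fderiv ℝ (fun z' => fderiv ℝ u z' k) z l) y m =
      fderiv ℝ (fun z => fderiv ℝ (fun z' => fderiv ℝ u z' m) z k) y l := by
  have hVy : V ∈ 𝓝 y := hV.mem_nhds hy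
  -- `g = ∂ₖ u` is `C²` on `V`
  have hg : ContDiffOn ℝ 2 (fun z => fderiv ℝ u z k) V :=
    contDiffOn_fderiv_apply_const hV (n := 2) (by exact_mod_cast hu) k
  have hgy : ContDiffAt ℝ 2 (fun z => fderiv ℝ u z k) y := hg.contDiffAt hVy
  rw [fderiv_fderiv_apply_comm hgy l m]
  -- `∂ₘ ∂ₖ u = ∂ₖ ∂ₘ u` near `y`
  have hev : (fun z => fderiv ℝ (fun z' => fderiv ℝ u z' k) z m) =ᶠ[𝓝 y]
      fun z => fderiv ℝ (fun z' => fderiv ℝ u z' m) z k := by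
    filter_upwards [hVy] with z hz
    have huz : ContDiffAt ℝ 2 u z :=
      (hu.of_le (by norm_num)).contDiffAt (hV.mem_nhds hz)
    exact fderiv_fderiv_apply_comm huz k m
  rw [hev.fderiv_eq]

end Symmetry

/-! ### Level zero: the Laplacian inequality from the equation -/

section LevelZero

variable [FiniteDimensional ℝ E] {ι : Type*} [Fintype ι] [DecidableEq ι]
  (b : OrthonormalBasis ι ℝ E)

omit [DecidableEq ι] in
/-- The Laplacian through pure second partial derivatives along an orthonormal basis, for a
function `C²` at the point. [folklore] -/
theorem laplacian_eq_sum_of_contDiffAt {u : E → ℝ} {y : E} (hu : ContDiffAt ℝ 2 u y) :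
    (Δ u) y = ∑ k, fderiv ℝ (fun z => fderiv ℝ u z (b k)) y (b k) := by
  rw [laplacian_eq_iteratedFDeriv_orthonormalBasis u b]
  refine Finset.sum_congr rfl fun k _ => ?_
  rw [iteratedFDeriv_two_apply, fderiv_fderiv_apply_eq_fderiv_fderiv hu]
  rfl

/-- A single term is bounded by the square root of a sum of squares. [folklore] -/
theorem abs_le_sqrt_sum_sq {κ : Type*} [Fintype κ] (x : κ → ℝ) (i : κ) :
    |x i| ≤ Real.sqrt (∑ j, x j ^ 2) := by
  rw [← Real.sqrt_sq_eq_abs]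
  exact Real.sqrt_le_sqrt (Finset.single_le_sum (f := fun j => x j ^ 2) (fun j _ => sq_nonneg _)
    (Finset.mem_univ i))

/-- A single term of a double family is bounded by the square root of the double sum of squares.
[folklore] -/
theorem abs_le_sqrt_sum_sum_sq {κ : Type*} [Fintype κ] (x : κ → κ → ℝ) (i j : κ) :
    |x i j| ≤ Real.sqrt (∑ k, ∑ l, x k l ^ 2) := by
  rw [← Real.sqrt_sq_eq_abs]
  refine Real.sqrt_le_sqrt ?_
  calc x i j ^ 2 ≤ ∑ l, x i l ^ 2 :=
        Finset.single_le_sum (f := fun l => x i l ^ 2) (fun l _ => sq_nonneg _) (Finset.mem_univ j)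
    _ ≤ ∑ k, ∑ l, x k l ^ 2 :=
        Finset.single_le_sum (f := fun k => ∑ l, x k l ^ 2)
          (fun k _ => Finset.sum_nonneg fun l _ => sq_nonneg _) (Finset.mem_univ i)

/-- **The Laplacian inequality from a second-order equation** (level zero). If `u` is `C²` at
`y` and `aₖₗ, βₖ, c` are numbers with `Σₖₗ |aₖₗ - δₖₗ| ≤ ε`, `Σₖ |βₖ| ≤ L₁`, then
`|Δu(y)| ≤ ε √(Σₖₗ(∂ₗ∂ₖu)²) + L₁ √(Σₖ(∂ₖu)²) + |c| |u| + |Σ aₖₗ ∂ₗ∂ₖu + Σ βₖ ∂ₖu + c u|` at `y`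
(`Δu = Σₖ ∂ₖ∂ₖu`, and the difference to the operator is `Σ(aₖₗ - δₖₗ)∂ₗ∂ₖu + Σβₖ∂ₖu + cu`).
[folklore] -/
theorem abs_laplacian_le_of_coeff {u : E → ℝ} {y : E} (hu : ContDiffAt ℝ 2 u y)
    (a : ι → ι → ℝ) (β : ι → ℝ) (c : ℝ) {ε L₁ : ℝ}
    (ha : ∑ k, ∑ l, |a k l - if k = l then 1 else 0| ≤ ε) (hβ : ∑ k, |β k| ≤ L₁) :
    |(Δ u) y| ≤
      ε * Real.sqrt (∑ k, ∑ l, (fderiv ℝ (fun z => fderiv ℝ u z (b k)) y (b l)) ^ 2)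
        + L₁ * Real.sqrt (∑ k, (fderiv ℝ u y (b k)) ^ 2) + |c| * |u y|
        + |∑ k, ∑ l, a k l * fderiv ℝ (fun z => fderiv ℝ u z (b k)) y (b l)
            + ∑ k, β k * fderiv ℝ u y (b k) + c * u y| := by
  set D2 : ι → ι → ℝ := fun k l => fderiv ℝ (fun z => fderiv ℝ u z (b k)) y (b l) with hD2
  set D1 : ι → ℝ := fun k => fderiv ℝ u y (b k) with hD1
  set R2 : ℝ := Real.sqrt (∑ k, ∑ l, D2 k l ^ 2) with hR2
  set R1 : ℝ := Real.sqrt (∑ k, D1 k ^ 2) with hR1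
  have hR2n : 0 ≤ R2 := Real.sqrt_nonneg _
  have hR1n : 0 ≤ R1 := Real.sqrt_nonneg _
  -- `Δu = Σ δₖₗ D2ₖₗ`
  have hΔ : (Δ u) y = ∑ k, ∑ l, (if k = l then (1 : ℝ) else 0) * D2 k l := by
    rw [laplacian_eq_sum_of_contDiffAt b hu]
    refine Finset.sum_congr rfl fun k _ => ?_
    rw [Finset.sum_eq_single k (fun l _ hl => by simp [Ne.symm hl]) (by simp)]
    simp [hD2]
  -- the difference identity
  have hid : (Δ u) y =
      (∑ k, ∑ l, a k l * D2 k l + ∑ k, β k * D1 k + c * u y)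
        - ∑ k, ∑ l, (a k l - if k = l then 1 else 0) * D2 k l
        - ∑ k, β k * D1 k - c * u y := by
    rw [hΔ]
    have e : ∑ k, ∑ l, (a k l - if k = l then (1:ℝ) else 0) * D2 k l =
        ∑ k, ∑ l, a k l * D2 k l - ∑ k, ∑ l, (if k = l then (1 : ℝ) else 0) * D2 k l := by
      rw [← Finset.sum_sub_distrib]
      refine Finset.sum_congr rfl fun k _ => ?_
      rw [← Finset.sum_sub_distrib]
      exact Finset.sum_congr rfl fun l _ => by ring
    rw [e]
    ring
  -- bounds for the two error sums
  have h2 : |∑ k, ∑ l, (a k l - if k = l then 1 else 0) * D2 k l| ≤ ε * R2 := by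
    calc |∑ k, ∑ l, (a k l - if k = l then 1 else 0) * D2 k l|
        ≤ ∑ k, |∑ l, (a k l - if k = l then 1 else 0) * D2 k l| := Finset.abs_sum_le_sum_abs _ _
      _ ≤ ∑ k, ∑ l, |(a k l - if k = l then 1 else 0) * D2 k l| :=
          Finset.sum_le_sum fun k _ => Finset.abs_sum_le_sum_abs _ _
      _ ≤ ∑ k, ∑ l, |a k l - if k = l then 1 else 0| * R2 := by
          refine Finset.sum_le_sum fun k _ => Finset.sum_le_sum fun l _ => ?_
          rw [abs_mul]
          exact mul_le_mul_of_nonneg_left (abs_le_sqrt_sum_sum_sq D2 k l) (abs_nonneg _)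
      _ = (∑ k, ∑ l, |a k l - if k = l then 1 else 0|) * R2 := by
          rw [Finset.sum_mul]
          exact Finset.sum_congr rfl fun k _ => by rw [Finset.sum_mul]
      _ ≤ ε * R2 := mul_le_mul_of_nonneg_right ha hR2n
  have h1 : |∑ k, β k * D1 k| ≤ L₁ * R1 := by
    calc |∑ k, β k * D1 k| ≤ ∑ k, |β k * D1 k| := Finset.abs_sum_le_sum_abs _ _
      _ ≤ ∑ k, |β k| * R1 := by
          refine Finset.sum_le_sum fun k _ => ?_
          rw [abs_mul]
          exact mul_le_mul_of_nonneg_left (abs_le_sqrt_sum_sq D1 k) (abs_nonneg _)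
      _ = (∑ k, |β k|) * R1 := by rw [Finset.sum_mul]
      _ ≤ L₁ * R1 := mul_le_mul_of_nonneg_right hβ hR1n
  have h0 : |c * u y| = |c| * |u y| := abs_mul _ _
  rw [hid]
  calc |(∑ k, ∑ l, a k l * D2 k l + ∑ k, β k * D1 k + c * u y)
          - ∑ k, ∑ l, (a k l - if k = l then 1 else 0) * D2 k l - ∑ k, β k * D1 k - c * u y|
      ≤ |∑ k, ∑ l, a k l * D2 k l + ∑ k, β k * D1 k + c * u y|
          + |∑ k, ∑ l, (a k l - if k = l then 1 else 0) * D2 k l| + |∑ k, β k * D1 k|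
          + |c * u y| := by
        have t1 := abs_sub (∑ k, ∑ l, a k l * D2 k l + ∑ k, β k * D1 k + c * u y
            - ∑ k, ∑ l, (a k l - if k = l then 1 else 0) * D2 k l - ∑ k, β k * D1 k) (c * u y)
        have t2 := abs_sub (∑ k, ∑ l, a k l * D2 k l + ∑ k, β k * D1 k + c * u y
            - ∑ k, ∑ l, (a k l - if k = l then 1 else 0) * D2 k l) (∑ k, β k * D1 k)
        have t3 := abs_sub (∑ k, ∑ l, a k l * D2 k l + ∑ k, β k * D1 k + c * u y)
            (∑ k, ∑ l, (a k l - if k = l then 1 else 0) * D2 k l)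
        linarith
    _ ≤ _ := by rw [h0]; linarith [h2, h1]

/-- **The Laplacian inequality for a solution** (level zero with the equation): if moreover
`Σ aₖₗ ∂ₗ∂ₖu + Σ βₖ ∂ₖu + c u = g` at `y`, then
`|Δu(y)| ≤ ε √(Σₖₗ(∂ₗ∂ₖu)²) + L₁ √(Σₖ(∂ₖu)²) + |c| |u| + |g|` at `y`. [folklore] -/
theorem abs_laplacian_le_of_eq {u : E → ℝ} {y : E} (hu : ContDiffAt ℝ 2 u y)
    (a : ι → ι → ℝ) (β : ι → ℝ) (c g : ℝ) {ε L₁ : ℝ}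
    (ha : ∑ k, ∑ l, |a k l - if k = l then 1 else 0| ≤ ε) (hβ : ∑ k, |β k| ≤ L₁)
    (heq : ∑ k, ∑ l, a k l * fderiv ℝ (fun z => fderiv ℝ u z (b k)) y (b l)
        + ∑ k, β k * fderiv ℝ u y (b k) + c * u y = g) :
    |(Δ u) y| ≤
      ε * Real.sqrt (∑ k, ∑ l, (fderiv ℝ (fun z => fderiv ℝ u z (b k)) y (b l)) ^ 2)
        + L₁ * Real.sqrt (∑ k, (fderiv ℝ u y (b k)) ^ 2) + |c| * |u y| + |g| := by
  have h := abs_laplacian_le_of_coeff b hu a β c ha hβ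
  rwa [heq] at h

end LevelZero

/-! ### Level one: differentiating the operator -/

section LevelOne

variable {ι : Type*} [Fintype ι] (b : OrthonormalBasis ι ℝ E)

/-- `∂ᵥ(fg) = (∂ᵥf) g + f ∂ᵥg` (pointwise form of `fderiv_mul`). [folklore] -/
theorem fderiv_mul_apply_of_differentiableAt {f g : E → ℝ} {x : E} (hf : DifferentiableAt ℝ f x)
    (hg : DifferentiableAt ℝ g x) (v : E) :
    fderiv ℝ (fun y => f y * g y) x v = fderiv ℝ f x v * g x + f x * fderiv ℝ g x v := by
  rw [fderiv_fun_mul hf hg]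
  simp only [_root_.add_apply, FunLike.coe_smul, Pi.smul_apply, smul_eq_mul]
  ring

/-- **Differentiating a second-order operator with variable coefficients** (the commutator
identity). For `u ∈ C³(V)`, `V` open, `y ∈ V`, and coefficients `aₖₗ, βₖ, c` differentiable at
`y`, with `Pf = Σₖₗ aₖₗ ∂ₗ∂ₖf + Σₖ βₖ ∂ₖf + c f`:
`∂ₘ(Pu)(y) = P(∂ₘu)(y) + (Σₖₗ ∂ₘaₖₗ ∂ₗ∂ₖu + Σₖ ∂ₘβₖ ∂ₖu + ∂ₘc u)(y)`
(mixed partial derivatives commute for `C³` functions). [folklore] -/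
theorem fderiv_secondOrderOp_apply {u : E → ℝ} {V : Set E} (hV : IsOpen V) {y : E} (hy : y ∈ V)
    (hu : ContDiffOn ℝ 3 u V) {a : ι → ι → E → ℝ} {β : ι → E → ℝ} {c : E → ℝ}
    (ha : ∀ k l, DifferentiableAt ℝ (a k l) y) (hβ : ∀ k, DifferentiableAt ℝ (β k) y)
    (hc : DifferentiableAt ℝ c y) (m : ι) :
    fderiv ℝ (fun z => ∑ k, ∑ l, a k l z * fderiv ℝ (fun z' => fderiv ℝ u z' (b k)) z (b l)
        + ∑ k, β k z * fderiv ℝ u z (b k) + c z * u z) y (b m) =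
      (∑ k, ∑ l, a k l y *
          fderiv ℝ (fun z => fderiv ℝ (fun z' => fderiv ℝ u z' (b m)) z (b k)) y (b l)
        + ∑ k, β k y * fderiv ℝ (fun z => fderiv ℝ u z (b m)) y (b k)
        + c y * fderiv ℝ u y (b m))
      + (∑ k, ∑ l, fderiv ℝ (a k l) y (b m) * fderiv ℝ (fun z' => fderiv ℝ u z' (b k)) y (b l)
        + ∑ k, fderiv ℝ (β k) y (b m) * fderiv ℝ u y (b k)
        + fderiv ℝ c y (b m) * u y) := by
  have hVy : V ∈ 𝓝 y := hV.mem_nhds hy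
  -- differentiability of the derivatives of `u` at `y`
  have hu2 : ContDiffOn ℝ 2 u V := hu.of_le (by norm_num)
  have huy2 : ContDiffAt ℝ 2 u y := hu2.contDiffAt hVy
  have hud : DifferentiableAt ℝ u y := huy2.differentiableAt two_ne_zero
  have hD1c : ∀ k, ContDiffOn ℝ 2 (fun z => fderiv ℝ u z (b k)) V := fun k =>
    contDiffOn_fderiv_apply_const hV (n := 2) (by exact_mod_cast hu) (b k)
  have hD1d : ∀ k, DifferentiableAt ℝ (fun z => fderiv ℝ u z (b k)) y := fun k =>
    ((hD1c k).contDiffAt hVy).differentiableAt two_ne_zero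
  have hD2c : ∀ k l, ContDiffOn ℝ 1 (fun z => fderiv ℝ (fun z' => fderiv ℝ u z' (b k)) z (b l)) V :=
    fun k l => contDiffOn_fderiv_apply_const hV (n := 1) (by exact_mod_cast hD1c k) (b l)
  have hD2d : ∀ k l, DifferentiableAt ℝ
      (fun z => fderiv ℝ (fun z' => fderiv ℝ u z' (b k)) z (b l)) y := fun k l =>
    ((hD2c k l).contDiffAt hVy).differentiableAt one_ne_zero
  -- differentiability of the summands
  have hT2 : ∀ k l, DifferentiableAt ℝ
      (fun z => a k l z * fderiv ℝ (fun z' => fderiv ℝ u z' (b k)) z (b l)) y :=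
    fun k l => (ha k l).mul (hD2d k l)
  have hT1 : ∀ k, DifferentiableAt ℝ (fun z => β k z * fderiv ℝ u z (b k)) y :=
    fun k => (hβ k).mul (hD1d k)
  have hT0 : DifferentiableAt ℝ (fun z => c z * u z) y := hc.mul hud
  have hS2 : DifferentiableAt ℝ
      (fun z => ∑ k, ∑ l, a k l z * fderiv ℝ (fun z' => fderiv ℝ u z' (b k)) z (b l)) y :=
    DifferentiableAt.fun_sum fun k _ => DifferentiableAt.fun_sum fun l _ => hT2 k l
  have hS1 : DifferentiableAt ℝ (fun z => ∑ k, β k z * fderiv ℝ u z (b k)) y :=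
    DifferentiableAt.fun_sum fun k _ => hT1 k
  -- differentiate the sum
  rw [fderiv_fun_add (hS2.fun_add hS1) hT0, fderiv_fun_add hS2 hS1, _root_.add_apply,
    _root_.add_apply, fderiv_fun_sum fun k _ => DifferentiableAt.fun_sum fun l _ => hT2 k l,
    fderiv_fun_sum fun k _ => hT1 k]
  simp only [FunLike.coe_sum, Finset.sum_apply]
  have hinner : ∀ k, fderiv ℝ (fun z => ∑ l, a k l z *
      fderiv ℝ (fun z' => fderiv ℝ u z' (b k)) z (b l)) y (b m) =
      ∑ l, fderiv ℝ (fun z => a k l z * fderiv ℝ (fun z' => fderiv ℝ u z' (b k)) z (b l)) y (b m) :=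
    fun k => by
      rw [fderiv_fun_sum fun l _ => hT2 k l]
      simp only [FunLike.coe_sum, Finset.sum_apply]
  simp_rw [hinner]
  -- the three Leibniz formulas, with commuted partial derivatives
  have e2 : ∀ k l, fderiv ℝ (fun z => a k l z * fderiv ℝ (fun z' => fderiv ℝ u z' (b k)) z (b l))
      y (b m) = fderiv ℝ (a k l) y (b m) * fderiv ℝ (fun z' => fderiv ℝ u z' (b k)) y (b l)
        + a k l y * fderiv ℝ (fun z => fderiv ℝ (fun z' => fderiv ℝ u z' (b m)) z (b k)) y (b l) := by
    intro k l
    rw [fderiv_mul_apply_of_differentiableAt (ha k l) (hD2d k l),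
      fderiv_fderiv_fderiv_comm hV hy hu (b k) (b l) (b m)]
  have e1 : ∀ k, fderiv ℝ (fun z => β k z * fderiv ℝ u z (b k)) y (b m) =
      fderiv ℝ (β k) y (b m) * fderiv ℝ u y (b k)
        + β k y * fderiv ℝ (fun z => fderiv ℝ u z (b m)) y (b k) := by
    intro k
    rw [fderiv_mul_apply_of_differentiableAt (hβ k) (hD1d k), fderiv_fderiv_apply_comm huy2]
  have e0 : fderiv ℝ (fun z => c z * u z) y (b m) =
      fderiv ℝ c y (b m) * u y + c y * fderiv ℝ u y (b m) :=
    fderiv_mul_apply_of_differentiableAt hc hud (b m)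
  simp only [e2, e1, e0, Finset.sum_add_distrib]
  ring

variable [FiniteDimensional ℝ E] [DecidableEq ι]

omit [FiniteDimensional ℝ E] [DecidableEq ι] in
/-- **Bound for the level-one commutator**: if `|∂ₘaₖₗ|, |∂ₘβₖ|, |∂ₘc| ≤ Λ₁` at `y`, then
`|Σₖₗ ∂ₘaₖₗ ∂ₗ∂ₖu + Σₖ ∂ₘβₖ ∂ₖu + ∂ₘc u| ≤ Λ₁ (Σₖₗ |∂ₗ∂ₖu| + Σₖ |∂ₖu| + |u|)` at `y`.
[folklore] -/
theorem abs_commutator_le {u : E → ℝ} {y : E} {a : ι → ι → E → ℝ} {β : ι → E → ℝ} {c : E → ℝ}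
    {Λ₁ : ℝ} (m : ι) (ha : ∀ k l, |fderiv ℝ (a k l) y (b m)| ≤ Λ₁)
    (hβ : ∀ k, |fderiv ℝ (β k) y (b m)| ≤ Λ₁) (hc : |fderiv ℝ c y (b m)| ≤ Λ₁) :
    |∑ k, ∑ l, fderiv ℝ (a k l) y (b m) * fderiv ℝ (fun z' => fderiv ℝ u z' (b k)) y (b l)
        + ∑ k, fderiv ℝ (β k) y (b m) * fderiv ℝ u y (b k) + fderiv ℝ c y (b m) * u y| ≤
      Λ₁ * (∑ k, ∑ l, |fderiv ℝ (fun z' => fderiv ℝ u z' (b k)) y (b l)|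
        + ∑ k, |fderiv ℝ u y (b k)| + |u y|) := by
  have h2 : |∑ k, ∑ l, fderiv ℝ (a k l) y (b m) * fderiv ℝ (fun z' => fderiv ℝ u z' (b k)) y (b l)|
      ≤ Λ₁ * ∑ k, ∑ l, |fderiv ℝ (fun z' => fderiv ℝ u z' (b k)) y (b l)| := by
    rw [Finset.mul_sum]
    refine (Finset.abs_sum_le_sum_abs _ _).trans (Finset.sum_le_sum fun k _ => ?_)
    rw [Finset.mul_sum]
    refine (Finset.abs_sum_le_sum_abs _ _).trans (Finset.sum_le_sum fun l _ => ?_)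
    rw [abs_mul]
    exact mul_le_mul_of_nonneg_right (ha k l) (abs_nonneg _)
  have h1 : |∑ k, fderiv ℝ (β k) y (b m) * fderiv ℝ u y (b k)| ≤ Λ₁ * ∑ k, |fderiv ℝ u y (b k)| := by
    rw [Finset.mul_sum]
    refine (Finset.abs_sum_le_sum_abs _ _).trans (Finset.sum_le_sum fun k _ => ?_)
    rw [abs_mul]
    exact mul_le_mul_of_nonneg_right (hβ k) (abs_nonneg _)
  have h0 : |fderiv ℝ c y (b m) * u y| ≤ Λ₁ * |u y| := by
    rw [abs_mul]
    exact mul_le_mul_of_nonneg_right hc (abs_nonneg _)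
  calc _ ≤ |∑ k, ∑ l, fderiv ℝ (a k l) y (b m) * fderiv ℝ (fun z' => fderiv ℝ u z' (b k)) y (b l)
            + ∑ k, fderiv ℝ (β k) y (b m) * fderiv ℝ u y (b k)| + |fderiv ℝ c y (b m) * u y| :=
        abs_add_le _ _
    _ ≤ |∑ k, ∑ l, fderiv ℝ (a k l) y (b m) * fderiv ℝ (fun z' => fderiv ℝ u z' (b k)) y (b l)|
          + |∑ k, fderiv ℝ (β k) y (b m) * fderiv ℝ u y (b k)| + |fderiv ℝ c y (b m) * u y| := by
        linarith [abs_add_le (∑ k, ∑ l, fderiv ℝ (a k l) y (b m) *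
          fderiv ℝ (fun z' => fderiv ℝ u z' (b k)) y (b l))
          (∑ k, fderiv ℝ (β k) y (b m) * fderiv ℝ u y (b k))]
    _ ≤ _ := by rw [mul_add, mul_add]; linarith

/-- **The Laplacian inequality for a first derivative of a solution** (level one). Let `V` be
open, `y ∈ V`, `u ∈ C³(V)` with `Pu = g` on `V` for `Pf = Σ aₖₗ ∂ₗ∂ₖf + Σ βₖ ∂ₖf + c f`, the
coefficients and `g` differentiable at `y`, `Σₖₗ |aₖₗ(y) - δₖₗ| ≤ ε`, `Σₖ |βₖ(y)| ≤ L₁` and all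
first partial derivatives of the coefficients bounded by `Λ₁` at `y`. Then `u' = ∂ₘu` satisfies
`|Δu'| ≤ ε √(Σₖₗ(∂ₗ∂ₖu')²) + L₁ √(Σₖ(∂ₖu')²) + |c| |u'| + |∂ₘg| + Λ₁ (Σₖₗ|∂ₗ∂ₖu| + Σₖ|∂ₖu| + |u|)`
at `y`. [folklore] -/
theorem abs_laplacian_fderiv_le {u g : E → ℝ} {V : Set E} (hV : IsOpen V) {y : E} (hy : y ∈ V)
    (hu : ContDiffOn ℝ 3 u V) {a : ι → ι → E → ℝ} {β : ι → E → ℝ} {c : E → ℝ}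
    (had : ∀ k l, DifferentiableAt ℝ (a k l) y) (hβd : ∀ k, DifferentiableAt ℝ (β k) y)
    (hcd : DifferentiableAt ℝ c y)
    (heq : ∀ z ∈ V, ∑ k, ∑ l, a k l z * fderiv ℝ (fun z' => fderiv ℝ u z' (b k)) z (b l)
        + ∑ k, β k z * fderiv ℝ u z (b k) + c z * u z = g z)
    {ε L₁ Λ₁ : ℝ} (ha : ∑ k, ∑ l, |a k l y - if k = l then 1 else 0| ≤ ε)
    (hβ : ∑ k, |β k y| ≤ L₁) (m : ι) (ha1 : ∀ k l, |fderiv ℝ (a k l) y (b m)| ≤ Λ₁)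
    (hβ1 : ∀ k, |fderiv ℝ (β k) y (b m)| ≤ Λ₁) (hc1 : |fderiv ℝ c y (b m)| ≤ Λ₁) :
    |(Δ fun z => fderiv ℝ u z (b m)) y| ≤
      ε * Real.sqrt (∑ k, ∑ l,
          (fderiv ℝ (fun z => fderiv ℝ (fun z' => fderiv ℝ u z' (b m)) z (b k)) y (b l)) ^ 2)
        + L₁ * Real.sqrt (∑ k, (fderiv ℝ (fun z => fderiv ℝ u z (b m)) y (b k)) ^ 2)
        + |c y| * |fderiv ℝ u y (b m)| + |fderiv ℝ g y (b m)|
        + Λ₁ * (∑ k, ∑ l, |fderiv ℝ (fun z' => fderiv ℝ u z' (b k)) y (b l)|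
          + ∑ k, |fderiv ℝ u y (b k)| + |u y|) := by
  have hVy : V ∈ 𝓝 y := hV.mem_nhds hy
  -- `u' = ∂ₘu` is `C²` at `y`
  have hu' : ContDiffOn ℝ 2 (fun z => fderiv ℝ u z (b m)) V :=
    contDiffOn_fderiv_apply_const hV (n := 2) (by exact_mod_cast hu) (b m)
  have hu'y : ContDiffAt ℝ 2 (fun z => fderiv ℝ u z (b m)) y := hu'.contDiffAt hVy
  -- level zero for `u'`
  have h0 := abs_laplacian_le_of_coeff b hu'y (fun k l => a k l y) (fun k => β k y) (c y) ha hβ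
  -- the operator on `u'` through the differentiated equation
  have hcomm := fderiv_secondOrderOp_apply b hV hy hu had hβd hcd m
  have hDg : fderiv ℝ (fun z => ∑ k, ∑ l, a k l z * fderiv ℝ (fun z' => fderiv ℝ u z' (b k)) z (b l)
      + ∑ k, β k z * fderiv ℝ u z (b k) + c z * u z) y (b m) = fderiv ℝ g y (b m) := by
    rw [Filter.EventuallyEq.fderiv_eq (Filter.eventuallyEq_of_mem hVy fun z hz => heq z hz)]
  rw [hDg] at hcomm
  -- `P u' = ∂ₘ g - comm`
  have hP : ∑ k, ∑ l, a k l y *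
        fderiv ℝ (fun z => fderiv ℝ (fun z' => fderiv ℝ u z' (b m)) z (b k)) y (b l)
      + ∑ k, β k y * fderiv ℝ (fun z => fderiv ℝ u z (b m)) y (b k)
      + c y * fderiv ℝ u y (b m) =
      fderiv ℝ g y (b m) -
        (∑ k, ∑ l, fderiv ℝ (a k l) y (b m) * fderiv ℝ (fun z' => fderiv ℝ u z' (b k)) y (b l)
          + ∑ k, fderiv ℝ (β k) y (b m) * fderiv ℝ u y (b k) + fderiv ℝ c y (b m) * u y) := by
    linarith
  have hcb := abs_commutator_le b (u := u) m ha1 hβ1 hc1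
  rw [hP] at h0
  have habs : |fderiv ℝ g y (b m) -
        (∑ k, ∑ l, fderiv ℝ (a k l) y (b m) * fderiv ℝ (fun z' => fderiv ℝ u z' (b k)) y (b l)
          + ∑ k, fderiv ℝ (β k) y (b m) * fderiv ℝ u y (b k) + fderiv ℝ c y (b m) * u y)| ≤
      |fderiv ℝ g y (b m)| +
        |∑ k, ∑ l, fderiv ℝ (a k l) y (b m) * fderiv ℝ (fun z' => fderiv ℝ u z' (b k)) y (b l)
          + ∑ k, fderiv ℝ (β k) y (b m) * fderiv ℝ u y (b k) + fderiv ℝ c y (b m) * u y| :=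
    abs_sub _ _
  linarith

end LevelOne

/-! ### Level two: differentiating twice -/

section LevelTwo

variable {ι : Type*} [Fintype ι] (b : OrthonormalBasis ι ℝ E)

/-- **The derivative of the level-one commutator.** For `u ∈ C³(V)` and coefficients in
`C²(V)`, `V` open, `y ∈ V`, the function `comm = Σₖₗ ∂ₘaₖₗ ∂ₗ∂ₖu + Σₖ ∂ₘβₖ ∂ₖu + ∂ₘc u` is
differentiable at `y` and `∂ₙ comm = Σₖₗ (∂ₙ∂ₘaₖₗ ∂ₗ∂ₖu + ∂ₘaₖₗ ∂ₗ∂ₖ∂ₙu)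
+ Σₖ (∂ₙ∂ₘβₖ ∂ₖu + ∂ₘβₖ ∂ₖ∂ₙu) + ∂ₙ∂ₘc u + ∂ₘc ∂ₙu` at `y` (mixed partial derivatives
commuted). [folklore] -/
theorem fderiv_commutator_apply {u : E → ℝ} {V : Set E} (hV : IsOpen V) {y : E} (hy : y ∈ V)
    (hu : ContDiffOn ℝ 3 u V) {a : ι → ι → E → ℝ} {β : ι → E → ℝ} {c : E → ℝ}
    (ha : ∀ k l, ContDiffOn ℝ 2 (a k l) V) (hβ : ∀ k, ContDiffOn ℝ 2 (β k) V)
    (hc : ContDiffOn ℝ 2 c V) (m n : ι) :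
    DifferentiableAt ℝ (fun z =>
      ∑ k, ∑ l, fderiv ℝ (a k l) z (b m) * fderiv ℝ (fun z' => fderiv ℝ u z' (b k)) z (b l)
        + ∑ k, fderiv ℝ (β k) z (b m) * fderiv ℝ u z (b k) + fderiv ℝ c z (b m) * u z) y ∧
    fderiv ℝ (fun z =>
      ∑ k, ∑ l, fderiv ℝ (a k l) z (b m) * fderiv ℝ (fun z' => fderiv ℝ u z' (b k)) z (b l)
        + ∑ k, fderiv ℝ (β k) z (b m) * fderiv ℝ u z (b k) + fderiv ℝ c z (b m) * u z) y (b n) =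
      ∑ k, ∑ l, (fderiv ℝ (fun z => fderiv ℝ (a k l) z (b m)) y (b n)
            * fderiv ℝ (fun z' => fderiv ℝ u z' (b k)) y (b l)
          + fderiv ℝ (a k l) y (b m)
            * fderiv ℝ (fun z => fderiv ℝ (fun z' => fderiv ℝ u z' (b n)) z (b k)) y (b l))
        + ∑ k, (fderiv ℝ (fun z => fderiv ℝ (β k) z (b m)) y (b n) * fderiv ℝ u y (b k)
          + fderiv ℝ (β k) y (b m) * fderiv ℝ (fun z => fderiv ℝ u z (b n)) y (b k))
        + (fderiv ℝ (fun z => fderiv ℝ c z (b m)) y (b n) * u y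
          + fderiv ℝ c y (b m) * fderiv ℝ u y (b n)) := by
  have hVy : V ∈ 𝓝 y := hV.mem_nhds hy
  have hu2 : ContDiffOn ℝ 2 u V := hu.of_le (by norm_num)
  have huy2 : ContDiffAt ℝ 2 u y := hu2.contDiffAt hVy
  have hud : DifferentiableAt ℝ u y := huy2.differentiableAt two_ne_zero
  have hD1c : ∀ k, ContDiffOn ℝ 2 (fun z => fderiv ℝ u z (b k)) V := fun k =>
    contDiffOn_fderiv_apply_const hV (n := 2) (by exact_mod_cast hu) (b k)
  have hD1d : ∀ k, DifferentiableAt ℝ (fun z => fderiv ℝ u z (b k)) y := fun k =>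
    ((hD1c k).contDiffAt hVy).differentiableAt two_ne_zero
  have hD2c : ∀ k l, ContDiffOn ℝ 1 (fun z => fderiv ℝ (fun z' => fderiv ℝ u z' (b k)) z (b l)) V :=
    fun k l => contDiffOn_fderiv_apply_const hV (n := 1) (by exact_mod_cast hD1c k) (b l)
  have hD2d : ∀ k l, DifferentiableAt ℝ
      (fun z => fderiv ℝ (fun z' => fderiv ℝ u z' (b k)) z (b l)) y := fun k l =>
    ((hD2c k l).contDiffAt hVy).differentiableAt one_ne_zero
  -- derivatives of the coefficients
  have hA1c : ∀ k l, ContDiffOn ℝ 1 (fun z => fderiv ℝ (a k l) z (b m)) V := fun k l =>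
    contDiffOn_fderiv_apply_const hV (n := 1) (by exact_mod_cast ha k l) (b m)
  have hA1d : ∀ k l, DifferentiableAt ℝ (fun z => fderiv ℝ (a k l) z (b m)) y := fun k l =>
    ((hA1c k l).contDiffAt hVy).differentiableAt one_ne_zero
  have hB1c : ∀ k, ContDiffOn ℝ 1 (fun z => fderiv ℝ (β k) z (b m)) V := fun k =>
    contDiffOn_fderiv_apply_const hV (n := 1) (by exact_mod_cast hβ k) (b m)
  have hB1d : ∀ k, DifferentiableAt ℝ (fun z => fderiv ℝ (β k) z (b m)) y := fun k =>
    ((hB1c k).contDiffAt hVy).differentiableAt one_ne_zero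
  have hC1c : ContDiffOn ℝ 1 (fun z => fderiv ℝ c z (b m)) V :=
    contDiffOn_fderiv_apply_const hV (n := 1) (by exact_mod_cast hc) (b m)
  have hC1d : DifferentiableAt ℝ (fun z => fderiv ℝ c z (b m)) y :=
    (hC1c.contDiffAt hVy).differentiableAt one_ne_zero
  -- the summands
  have hT2 : ∀ k l, DifferentiableAt ℝ (fun z => fderiv ℝ (a k l) z (b m)
      * fderiv ℝ (fun z' => fderiv ℝ u z' (b k)) z (b l)) y := fun k l => (hA1d k l).mul (hD2d k l)
  have hT1 : ∀ k, DifferentiableAt ℝ (fun z => fderiv ℝ (β k) z (b m) * fderiv ℝ u z (b k)) y :=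
    fun k => (hB1d k).mul (hD1d k)
  have hT0 : DifferentiableAt ℝ (fun z => fderiv ℝ c z (b m) * u z) y := hC1d.mul hud
  have hS2 : DifferentiableAt ℝ (fun z => ∑ k, ∑ l, fderiv ℝ (a k l) z (b m)
      * fderiv ℝ (fun z' => fderiv ℝ u z' (b k)) z (b l)) y :=
    DifferentiableAt.fun_sum fun k _ => DifferentiableAt.fun_sum fun l _ => hT2 k l
  have hS1 : DifferentiableAt ℝ (fun z => ∑ k, fderiv ℝ (β k) z (b m) * fderiv ℝ u z (b k)) y :=
    DifferentiableAt.fun_sum fun k _ => hT1 k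
  refine ⟨(hS2.fun_add hS1).fun_add hT0, ?_⟩
  rw [fderiv_fun_add (hS2.fun_add hS1) hT0, fderiv_fun_add hS2 hS1, _root_.add_apply,
    _root_.add_apply, fderiv_fun_sum fun k _ => DifferentiableAt.fun_sum fun l _ => hT2 k l,
    fderiv_fun_sum fun k _ => hT1 k]
  simp only [FunLike.coe_sum, Finset.sum_apply]
  have hinner : ∀ k, fderiv ℝ (fun z => ∑ l, fderiv ℝ (a k l) z (b m) *
      fderiv ℝ (fun z' => fderiv ℝ u z' (b k)) z (b l)) y (b n) =
      ∑ l, fderiv ℝ (fun z => fderiv ℝ (a k l) z (b m) *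
        fderiv ℝ (fun z' => fderiv ℝ u z' (b k)) z (b l)) y (b n) := fun k => by
    rw [fderiv_fun_sum fun l _ => hT2 k l]
    simp only [FunLike.coe_sum, Finset.sum_apply]
  simp_rw [hinner]
  -- Leibniz with commuted partial derivatives
  have e2 : ∀ k l, fderiv ℝ (fun z => fderiv ℝ (a k l) z (b m) *
      fderiv ℝ (fun z' => fderiv ℝ u z' (b k)) z (b l)) y (b n) =
      fderiv ℝ (fun z => fderiv ℝ (a k l) z (b m)) y (b n)
          * fderiv ℝ (fun z' => fderiv ℝ u z' (b k)) y (b l)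
        + fderiv ℝ (a k l) y (b m)
          * fderiv ℝ (fun z => fderiv ℝ (fun z' => fderiv ℝ u z' (b n)) z (b k)) y (b l) := by
    intro k l
    rw [fderiv_mul_apply_of_differentiableAt (hA1d k l) (hD2d k l),
      fderiv_fderiv_fderiv_comm hV hy hu (b k) (b l) (b n)]
  have e1 : ∀ k, fderiv ℝ (fun z => fderiv ℝ (β k) z (b m) * fderiv ℝ u z (b k)) y (b n) =
      fderiv ℝ (fun z => fderiv ℝ (β k) z (b m)) y (b n) * fderiv ℝ u y (b k)
        + fderiv ℝ (β k) y (b m) * fderiv ℝ (fun z => fderiv ℝ u z (b n)) y (b k) := by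
    intro k
    rw [fderiv_mul_apply_of_differentiableAt (hB1d k) (hD1d k), fderiv_fderiv_apply_comm huy2]
  have e0 : fderiv ℝ (fun z => fderiv ℝ c z (b m) * u z) y (b n) =
      fderiv ℝ (fun z => fderiv ℝ c z (b m)) y (b n) * u y
        + fderiv ℝ c y (b m) * fderiv ℝ u y (b n) :=
    fderiv_mul_apply_of_differentiableAt hC1d hud (b n)
  simp only [e2, e1, e0]

/-- Bookkeeping bound for the differentiated commutator. [folklore] -/
theorem abs_commutator_expansion_le {A2 A1 D2u D2un : ι → ι → ℝ} {B2 B1 D1u D1un : ι → ℝ}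
    {C2 C1 u0 un Λ₁ Λ₂ : ℝ} (hA2 : ∀ k l, |A2 k l| ≤ Λ₂) (hA1 : ∀ k l, |A1 k l| ≤ Λ₁)
    (hB2 : ∀ k, |B2 k| ≤ Λ₂) (hB1 : ∀ k, |B1 k| ≤ Λ₁) (hC2 : |C2| ≤ Λ₂) (hC1 : |C1| ≤ Λ₁) :
    |∑ k, ∑ l, (A2 k l * D2u k l + A1 k l * D2un k l) + ∑ k, (B2 k * D1u k + B1 k * D1un k)
        + (C2 * u0 + C1 * un)| ≤
      Λ₂ * (∑ k, ∑ l, |D2u k l| + ∑ k, |D1u k| + |u0|)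
        + Λ₁ * (∑ k, ∑ l, |D2un k l| + ∑ k, |D1un k| + |un|) := by
  have h2 : |∑ k, ∑ l, (A2 k l * D2u k l + A1 k l * D2un k l)| ≤
      Λ₂ * ∑ k, ∑ l, |D2u k l| + Λ₁ * ∑ k, ∑ l, |D2un k l| := by
    rw [Finset.mul_sum, Finset.mul_sum, ← Finset.sum_add_distrib]
    refine (Finset.abs_sum_le_sum_abs _ _).trans (Finset.sum_le_sum fun k _ => ?_)
    rw [Finset.mul_sum, Finset.mul_sum, ← Finset.sum_add_distrib]
    refine (Finset.abs_sum_le_sum_abs _ _).trans (Finset.sum_le_sum fun l _ => ?_)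
    calc |A2 k l * D2u k l + A1 k l * D2un k l| ≤ |A2 k l * D2u k l| + |A1 k l * D2un k l| :=
          abs_add_le _ _
      _ ≤ Λ₂ * |D2u k l| + Λ₁ * |D2un k l| := by
          rw [abs_mul, abs_mul]
          exact add_le_add (mul_le_mul_of_nonneg_right (hA2 k l) (abs_nonneg _))
            (mul_le_mul_of_nonneg_right (hA1 k l) (abs_nonneg _))
  have h1 : |∑ k, (B2 k * D1u k + B1 k * D1un k)| ≤
      Λ₂ * ∑ k, |D1u k| + Λ₁ * ∑ k, |D1un k| := by
    rw [Finset.mul_sum, Finset.mul_sum, ← Finset.sum_add_distrib]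
    refine (Finset.abs_sum_le_sum_abs _ _).trans (Finset.sum_le_sum fun k _ => ?_)
    calc |B2 k * D1u k + B1 k * D1un k| ≤ |B2 k * D1u k| + |B1 k * D1un k| := abs_add_le _ _
      _ ≤ Λ₂ * |D1u k| + Λ₁ * |D1un k| := by
          rw [abs_mul, abs_mul]
          exact add_le_add (mul_le_mul_of_nonneg_right (hB2 k) (abs_nonneg _))
            (mul_le_mul_of_nonneg_right (hB1 k) (abs_nonneg _))
  have h0 : |C2 * u0 + C1 * un| ≤ Λ₂ * |u0| + Λ₁ * |un| := by
    calc |C2 * u0 + C1 * un| ≤ |C2 * u0| + |C1 * un| := abs_add_le _ _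
      _ ≤ Λ₂ * |u0| + Λ₁ * |un| := by
          rw [abs_mul, abs_mul]
          exact add_le_add (mul_le_mul_of_nonneg_right hC2 (abs_nonneg _))
            (mul_le_mul_of_nonneg_right hC1 (abs_nonneg _))
  have hsum := abs_add_le (∑ k, ∑ l, (A2 k l * D2u k l + A1 k l * D2un k l)
      + ∑ k, (B2 k * D1u k + B1 k * D1un k)) (C2 * u0 + C1 * un)
  have hsum' := abs_add_le (∑ k, ∑ l, (A2 k l * D2u k l + A1 k l * D2un k l))
      (∑ k, (B2 k * D1u k + B1 k * D1un k))
  rw [mul_add, mul_add, mul_add, mul_add]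
  linarith

variable [FiniteDimensional ℝ E] [DecidableEq ι]

/-- **The Laplacian inequality for a second derivative of a solution** (level two). Let `V` be
open, `y ∈ V`, `u ∈ C⁴(V)` with `Pu = g` on `V` for `Pf = Σ aₖₗ ∂ₗ∂ₖf + Σ βₖ ∂ₖf + c f`, the
coefficients and `g` in `C²(V)`, `Σₖₗ |aₖₗ(y) - δₖₗ| ≤ ε`, `Σₖ |βₖ(y)| ≤ L₁`, all first partial
derivatives of the coefficients bounded by `Λ₁` and all second ones by `Λ₂` at `y`. Then
`U = ∂ₙ∂ₘu` satisfies, at `y`,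
`|ΔU| ≤ ε √(Σₖₗ(∂ₗ∂ₖU)²) + L₁ √(Σₖ(∂ₖU)²) + |c| |U| + |∂ₙ∂ₘg|
  + Λ₁ Tₘ + Λ₂ (Σₖₗ|∂ₗ∂ₖu| + Σₖ|∂ₖu| + |u|) + Λ₁ Tₙ`,
`Tᵢ = Σₖₗ|∂ₗ∂ₖ∂ᵢu| + Σₖ|∂ₖ∂ᵢu| + |∂ᵢu|` (differentiate the level-one equation once more).
[folklore] -/
theorem abs_laplacian_fderiv_fderiv_le {u g : E → ℝ} {V : Set E} (hV : IsOpen V) {y : E}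
    (hy : y ∈ V) (hu : ContDiffOn ℝ 4 u V) {a : ι → ι → E → ℝ} {β : ι → E → ℝ} {c : E → ℝ}
    (ha2 : ∀ k l, ContDiffOn ℝ 2 (a k l) V) (hβ2 : ∀ k, ContDiffOn ℝ 2 (β k) V)
    (hc2 : ContDiffOn ℝ 2 c V) (hg : ContDiffOn ℝ 2 g V)
    (heq : ∀ z ∈ V, ∑ k, ∑ l, a k l z * fderiv ℝ (fun z' => fderiv ℝ u z' (b k)) z (b l)
        + ∑ k, β k z * fderiv ℝ u z (b k) + c z * u z = g z)
    {ε L₁ Λ₁ Λ₂ : ℝ} (ha : ∑ k, ∑ l, |a k l y - if k = l then 1 else 0| ≤ ε)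
    (hβ : ∑ k, |β k y| ≤ L₁)
    (ha1 : ∀ k l i, |fderiv ℝ (a k l) y (b i)| ≤ Λ₁) (hβ1 : ∀ k i, |fderiv ℝ (β k) y (b i)| ≤ Λ₁)
    (hc1 : ∀ i, |fderiv ℝ c y (b i)| ≤ Λ₁)
    (ha2b : ∀ k l i j, |fderiv ℝ (fun z => fderiv ℝ (a k l) z (b i)) y (b j)| ≤ Λ₂)
    (hβ2b : ∀ k i j, |fderiv ℝ (fun z => fderiv ℝ (β k) z (b i)) y (b j)| ≤ Λ₂)
    (hc2b : ∀ i j, |fderiv ℝ (fun z => fderiv ℝ c z (b i)) y (b j)| ≤ Λ₂) (m n : ι) :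
    |(Δ fun z => fderiv ℝ (fun z' => fderiv ℝ u z' (b m)) z (b n)) y| ≤
      ε * Real.sqrt (∑ k, ∑ l, (fderiv ℝ (fun z => fderiv ℝ
          (fun z' => fderiv ℝ (fun z'' => fderiv ℝ u z'' (b m)) z' (b n)) z (b k)) y (b l)) ^ 2)
        + L₁ * Real.sqrt (∑ k, (fderiv ℝ
          (fun z => fderiv ℝ (fun z' => fderiv ℝ u z' (b m)) z (b n)) y (b k)) ^ 2)
        + |c y| * |fderiv ℝ (fun z' => fderiv ℝ u z' (b m)) y (b n)|
        + |fderiv ℝ (fun z => fderiv ℝ g z (b m)) y (b n)|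
        + Λ₁ * (∑ k, ∑ l, |fderiv ℝ (fun z => fderiv ℝ (fun z' => fderiv ℝ u z' (b m)) z (b k))
              y (b l)|
            + ∑ k, |fderiv ℝ (fun z => fderiv ℝ u z (b m)) y (b k)| + |fderiv ℝ u y (b m)|)
        + Λ₂ * (∑ k, ∑ l, |fderiv ℝ (fun z' => fderiv ℝ u z' (b k)) y (b l)|
            + ∑ k, |fderiv ℝ u y (b k)| + |u y|)
        + Λ₁ * (∑ k, ∑ l, |fderiv ℝ (fun z => fderiv ℝ (fun z' => fderiv ℝ u z' (b n)) z (b k))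
              y (b l)|
            + ∑ k, |fderiv ℝ (fun z => fderiv ℝ u z (b n)) y (b k)| + |fderiv ℝ u y (b n)|) := by
  have hVy : V ∈ 𝓝 y := hV.mem_nhds hy
  have hu3 : ContDiffOn ℝ 3 u V := hu.of_le (by norm_num)
  -- differentiability of the coefficients on `V`
  have had : ∀ z ∈ V, ∀ k l, DifferentiableAt ℝ (a k l) z := fun z hz k l =>
    ((ha2 k l).contDiffAt (hV.mem_nhds hz)).differentiableAt two_ne_zero
  have hβd : ∀ z ∈ V, ∀ k, DifferentiableAt ℝ (β k) z := fun z hz k =>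
    ((hβ2 k).contDiffAt (hV.mem_nhds hz)).differentiableAt two_ne_zero
  have hcd : ∀ z ∈ V, DifferentiableAt ℝ c z := fun z hz =>
    (hc2.contDiffAt (hV.mem_nhds hz)).differentiableAt two_ne_zero
  -- `u' = ∂ₘ u ∈ C³(V)` and its equation `P u' = g'`
  set u' : E → ℝ := fun z => fderiv ℝ u z (b m) with hu'def
  have hu' : ContDiffOn ℝ 3 u' V := contDiffOn_fderiv_apply_const hV (n := 3) (by exact_mod_cast hu) (b m)
  set comm : E → ℝ := fun z =>
    ∑ k, ∑ l, fderiv ℝ (a k l) z (b m) * fderiv ℝ (fun z' => fderiv ℝ u z' (b k)) z (b l)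
      + ∑ k, fderiv ℝ (β k) z (b m) * fderiv ℝ u z (b k) + fderiv ℝ c z (b m) * u z with hcomm
  set g' : E → ℝ := fun z => fderiv ℝ g z (b m) - comm z with hg'def
  have heq' : ∀ z ∈ V, ∑ k, ∑ l, a k l z * fderiv ℝ (fun z' => fderiv ℝ u' z' (b k)) z (b l)
      + ∑ k, β k z * fderiv ℝ u' z (b k) + c z * u' z = g' z := by
    intro z hz
    have hc0 := fderiv_secondOrderOp_apply b hV hz hu3 (had z hz) (hβd z hz) (hcd z hz) m
    have hDg : fderiv ℝ (fun w => ∑ k, ∑ l, a k l w * fderiv ℝ (fun z' => fderiv ℝ u z' (b k)) w (b l)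
        + ∑ k, β k w * fderiv ℝ u w (b k) + c w * u w) z (b m) = fderiv ℝ g z (b m) := by
      rw [Filter.EventuallyEq.fderiv_eq
        (Filter.eventuallyEq_of_mem (hV.mem_nhds hz) fun w hw => heq w hw)]
    rw [hDg] at hc0
    simp only [hg'def, hcomm, hu'def]
    linarith
  -- level one for `u'` in the direction `n`
  have h1 := abs_laplacian_fderiv_le b hV hy hu' (had y hy) (hβd y hy) (hcd y hy) heq' ha hβ n
    (fun k l => ha1 k l n) (fun k => hβ1 k n) (hc1 n)
  -- the derivative of `g'`
  obtain ⟨hcommd, hcommD⟩ := fderiv_commutator_apply b hV hy hu3 ha2 hβ2 hc2 m n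
  have hDgm : ContDiffOn ℝ 1 (fun z => fderiv ℝ g z (b m)) V :=
    contDiffOn_fderiv_apply_const hV (n := 1) (by exact_mod_cast hg) (b m)
  have hDgmd : DifferentiableAt ℝ (fun z => fderiv ℝ g z (b m)) y :=
    (hDgm.contDiffAt hVy).differentiableAt one_ne_zero
  have hg'D : fderiv ℝ g' y (b n) = fderiv ℝ (fun z => fderiv ℝ g z (b m)) y (b n) - fderiv ℝ comm y (b n) := by
    simp only [hg'def]
    rw [fderiv_fun_sub hDgmd hcommd]
    rfl
  have hexp := abs_commutator_expansion_le (ι := ι)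
    (A2 := fun k l => fderiv ℝ (fun z => fderiv ℝ (a k l) z (b m)) y (b n))
    (A1 := fun k l => fderiv ℝ (a k l) y (b m))
    (D2u := fun k l => fderiv ℝ (fun z' => fderiv ℝ u z' (b k)) y (b l))
    (D2un := fun k l => fderiv ℝ (fun z => fderiv ℝ (fun z' => fderiv ℝ u z' (b n)) z (b k)) y (b l))
    (B2 := fun k => fderiv ℝ (fun z => fderiv ℝ (β k) z (b m)) y (b n))
    (B1 := fun k => fderiv ℝ (β k) y (b m)) (D1u := fun k => fderiv ℝ u y (b k))
    (D1un := fun k => fderiv ℝ (fun z => fderiv ℝ u z (b n)) y (b k))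
    (C2 := fderiv ℝ (fun z => fderiv ℝ c z (b m)) y (b n)) (C1 := fderiv ℝ c y (b m))
    (u0 := u y) (un := fderiv ℝ u y (b n))
    (fun k l => ha2b k l m n) (fun k l => ha1 k l m) (fun k => hβ2b k m n) (fun k => hβ1 k m)
    (hc2b m n) (hc1 m)
  rw [← hcommD] at hexp
  have hg'b : |fderiv ℝ g' y (b n)| ≤ |fderiv ℝ (fun z => fderiv ℝ g z (b m)) y (b n)|
      + |fderiv ℝ comm y (b n)| := by
    rw [hg'D]; exact abs_sub _ _
  -- `u'` terms are the `∂ₘ` terms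
  simp only [hu'def] at h1
  linarith [h1, hg'b, hexp]

end LevelTwo

end Literature.Analysis.PDE
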